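import Summits.Schanuel.Schanuel.Theorems.RootDecomp1KHyper29
import Summits.Schanuel.Schanuel.Theorems.RootDecomp1KGaugeResidual

/-!
# RootDecomp1KHyper — lens 6, generation 15 ADDENDUM 4 «UNIFORM n-PARAMETRIC ANCHORED THEOREM» (MeasuredAnchors.lean d7ef80c6…, 1059 l) — part 1 (RootDecomp1KHyper42): §A length algebra of `mvlen` (sub-additivity, SUB-MULTIPLICATIVITY `mvlen_mul_le`, `mvlen_homogSubst_le`); §B the predicate `HyperPolyApprox θ d y` and `HyperPolyApprox.mono_level`

`∀ k`, for a ℚ-free `z : Fin (k+1) → ℂ` with hyper-small linear forms (`HyperLinLiouville z`), a weakly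
measured `k`-tuple `θ ⊂ ℚ(z, e^z, i)` (`MvWeakMeasure θ`) and `k` polynomially independent ℚ(θ)-rational
anchors `vᵢ = Wᵢ(θ)/q(θ) ∈ span_ℤ(z)`: Schanuel's bound `trdeg ℚ(z, e^z) ≥ k + 1` — ONE proof for all `k`.
§A the length algebra of `mvlen` (sub-multiplicativity); §B the HYPER-POLYNOMIAL-APPROXIMATION ENGINE
(`HyperPolyApprox θ d y`; kernel `no_int_relation_of_mvWeakMeasure_hyperPoly`); §C SIEGEL'S LEMMA
(Mathlib `Int.Matrix.exists_ne_zero_int_vec_norm_le`) + the k-ary weak lattice bound + k-ary weak Lemma L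
(`hyperPolyApprox_of_anchors`); §D the theorem `sb_of_measuredRatAnchors` (all `k`) and its `k = 2` instance.

(lens-6 g15 ADDENDUM 4 `MeasuredAnchors.lean`, sha256 d7ef80c6…6d97, own farm rc 0 · 0 sorry · axioms std; critic VERDICT STATUS L1634
(K-R18 MET; PORT GO (e)), CENSUS-REQUEST L1629; port by census-1 gen 15 in FIVE parts RootDecomp1KHyper42–46 (the request's L₁ = ll. 1–410
exceeds the 400-line cap and is cut before the §B analytic helpers: 42 = §A + `HyperPolyApprox`, 43 = §B engine, 44 = §C Anchors/AnchorsTwo,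
45 = §C AnchorsMain, 46 = §D); statements and proofs verbatim; 16 one-line docstrings added; `mul_exp_neg_le_one` and the two primed §D
copies of PiAnchorU §9 lemmas (`aeval_int_mem_adjoin'`, `algebraicIndependent_option_of_mul'` — twins of RootDecomp1KHyper41) made
`private`; `--supports stmt-Schanuel-33363`, no census credit. Nothing here proves Schanuel; rung 0.)
-/

open Complex IntermediateField Polynomial

namespace Summit.Schanuel.Schanuel.Theorems.RootDecomp1KHyper

variable {n : ℕ}

/-! ## §A  Length algebra of `mvlen` -/

/-- The length of the zero polynomial is `0`. -/
theorem mvlen_zero : mvlen (0 : MvPolynomial (Fin n) ℤ) = 0 := by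
  simp [mvlen]

/-- The length of a monomial `c · x^a` is `|c|`. -/
theorem mvlen_monomial (a : Fin n →₀ ℕ) (c : ℤ) : mvlen (MvPolynomial.monomial a c) = |c| := by
  classical
  rw [mvlen_eq_sum_of_support_subset _ MvPolynomial.support_monomial_subset, Finset.sum_singleton,
    MvPolynomial.coeff_monomial, if_pos rfl]

/-- The length of a constant `C c` is `|c|`. -/
theorem mvlen_C (c : ℤ) : mvlen (MvPolynomial.C c : MvPolynomial (Fin n) ℤ) = |c| := by
  rw [MvPolynomial.C_apply, mvlen_monomial]

/-- The length of `1` is `1`. -/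
theorem mvlen_one : mvlen (1 : MvPolynomial (Fin n) ℤ) = 1 := by
  rw [← MvPolynomial.C_1, mvlen_C, abs_one]

/-- The length of a variable `X i` is `1`. -/
theorem mvlen_X (i : Fin n) : mvlen (MvPolynomial.X i : MvPolynomial (Fin n) ℤ) = 1 := by
  rw [MvPolynomial.X, mvlen_monomial, abs_one]

/-- The length is invariant under negation. -/
theorem mvlen_neg (P : MvPolynomial (Fin n) ℤ) : mvlen (-P) = mvlen P := by
  unfold mvlen
  rw [MvPolynomial.support_neg]
  exact Finset.sum_congr rfl fun m _ => by rw [MvPolynomial.coeff_neg, abs_neg]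

/-- Subadditivity of the length. -/
theorem mvlen_add_le (P Q : MvPolynomial (Fin n) ℤ) : mvlen (P + Q) ≤ mvlen P + mvlen Q := by
  classical
  have hs : (P + Q).support ⊆ P.support ∪ Q.support := MvPolynomial.support_add
  rw [mvlen_eq_sum_of_support_subset _ hs,
    mvlen_eq_sum_of_support_subset P (Finset.subset_union_left (s₂ := Q.support)),
    mvlen_eq_sum_of_support_subset Q (Finset.subset_union_right (s₁ := P.support)),
    ← Finset.sum_add_distrib]
  exact Finset.sum_le_sum fun m _ => by rw [MvPolynomial.coeff_add]; exact abs_add_le _ _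

/-- Subadditivity of the length for differences: `mvlen (P − Q) ≤ mvlen P + mvlen Q`. -/
theorem mvlen_sub_le (P Q : MvPolynomial (Fin n) ℤ) : mvlen (P - Q) ≤ mvlen P + mvlen Q := by
  rw [sub_eq_add_neg, ← mvlen_neg Q]; exact mvlen_add_le _ _

/-- The length of a finite sum is at most the sum of the lengths. -/
theorem mvlen_sum_le {ι : Type*} (s : Finset ι) (F : ι → MvPolynomial (Fin n) ℤ) :
    mvlen (∑ i ∈ s, F i) ≤ ∑ i ∈ s, mvlen (F i) :=
  Finset.le_sum_of_subadditive mvlen mvlen_zero.le mvlen_add_le s F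

/-- **Submultiplicativity of the length**: `mvlen (P Q) ≤ mvlen P · mvlen Q`. -/
theorem mvlen_mul_le (P Q : MvPolynomial (Fin n) ℤ) : mvlen (P * Q) ≤ mvlen P * mvlen Q := by
  classical
  have hPQ : P * Q = ∑ a ∈ P.support, ∑ b ∈ Q.support,
      MvPolynomial.monomial (a + b) (P.coeff a * Q.coeff b) := by
    conv_lhs => rw [P.as_sum, Q.as_sum]
    rw [Finset.sum_mul]
    refine Finset.sum_congr rfl fun a _ => ?_
    rw [Finset.mul_sum]
    refine Finset.sum_congr rfl fun b _ => ?_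
    rw [MvPolynomial.monomial_mul]
  rw [hPQ]
  calc mvlen (∑ a ∈ P.support, ∑ b ∈ Q.support,
          MvPolynomial.monomial (a + b) (P.coeff a * Q.coeff b))
      ≤ ∑ a ∈ P.support, mvlen (∑ b ∈ Q.support,
          MvPolynomial.monomial (a + b) (P.coeff a * Q.coeff b)) := mvlen_sum_le _ _
    _ ≤ ∑ a ∈ P.support, ∑ b ∈ Q.support, |P.coeff a * Q.coeff b| := by
        refine Finset.sum_le_sum fun a _ => (mvlen_sum_le _ _).trans (Finset.sum_le_sum fun b _ => ?_)
        rw [mvlen_monomial]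
    _ = mvlen P * mvlen Q := by
        unfold mvlen
        rw [Finset.sum_mul]
        refine Finset.sum_congr rfl fun a _ => ?_
        rw [Finset.mul_sum]
        exact Finset.sum_congr rfl fun b _ => by rw [abs_mul]

/-- `mvlen (P^k) ≤ (mvlen P)^k`. -/
theorem mvlen_pow_le (P : MvPolynomial (Fin n) ℤ) (k : ℕ) : mvlen (P ^ k) ≤ mvlen P ^ k := by
  induction k with
  | zero => rw [pow_zero, pow_zero, mvlen_one]
  | succ k ih =>
    rw [pow_succ, pow_succ]
    exact (mvlen_mul_le _ _).trans (mul_le_mul_of_nonneg_right ih (mvlen_nonneg P))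

/-- The length of a finite product is at most the product of the lengths. -/
theorem mvlen_prod_le {ι : Type*} (s : Finset ι) (F : ι → MvPolynomial (Fin n) ℤ) :
    mvlen (∏ i ∈ s, F i) ≤ ∏ i ∈ s, mvlen (F i) := by
  classical
  refine Finset.induction_on s ?_ ?_
  · rw [Finset.prod_empty, Finset.prod_empty, mvlen_one]
  · intro a s ha ih
    rw [Finset.prod_insert ha, Finset.prod_insert ha]
    exact (mvlen_mul_le _ _).trans (mul_le_mul (le_refl _) ih (mvlen_nonneg _) (mvlen_nonneg _))

/-- `mvlen (C c · P) ≤ |c| · mvlen P`. -/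
theorem mvlen_C_mul_le (c : ℤ) (P : MvPolynomial (Fin n) ℤ) :
    mvlen (MvPolynomial.C c * P) ≤ |c| * mvlen P :=
  calc mvlen (MvPolynomial.C c * P) ≤ mvlen (MvPolynomial.C c) * mvlen P := mvlen_mul_le _ _
    _ = |c| * mvlen P := by rw [mvlen_C]

/-- The shape used by the engines: an integer combination `Σ_k G_k · P^k · E^{K−k}` has length
`≤ Σ_k mvlen(G_k) · mvlen(P)^k · E^{K−k}`. -/
theorem mvlen_homogSubst_le {K : ℕ} (G : Fin (K + 1) → MvPolynomial (Fin n) ℤ)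
    (P : MvPolynomial (Fin n) ℤ) (E : ℕ) :
    mvlen (∑ k : Fin (K + 1), G k * P ^ (k : ℕ) * MvPolynomial.C ((E : ℤ) ^ (K - k))) ≤
      ∑ k : Fin (K + 1), mvlen (G k) * mvlen P ^ (k : ℕ) * (E : ℤ) ^ (K - k) := by
  refine (mvlen_sum_le _ _).trans (Finset.sum_le_sum fun k _ => ?_)
  have h1 := mvlen_mul_le (G k * P ^ (k : ℕ)) (MvPolynomial.C ((E : ℤ) ^ (K - (k : ℕ))))
  have h2 := mvlen_mul_le (G k) (P ^ (k : ℕ))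
  have h3 := mvlen_pow_le P k
  have hE : mvlen (MvPolynomial.C ((E : ℤ) ^ (K - (k : ℕ))) : MvPolynomial (Fin n) ℤ) =
      (E : ℤ) ^ (K - (k : ℕ)) := by
    rw [mvlen_C, abs_of_nonneg (by positivity)]
  rw [hE] at h1
  calc mvlen (G k * P ^ (k : ℕ) * MvPolynomial.C ((E : ℤ) ^ (K - (k : ℕ))))
      ≤ mvlen (G k * P ^ (k : ℕ)) * (E : ℤ) ^ (K - (k : ℕ)) := h1
    _ ≤ mvlen (G k) * mvlen P ^ (k : ℕ) * (E : ℤ) ^ (K - (k : ℕ)) := by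
        apply mul_le_mul_of_nonneg_right _ (by positivity)
        exact h2.trans (mul_le_mul_of_nonneg_left h3 (mvlen_nonneg _))

namespace HyperCell

/-! ## §B  The hyper-polynomial-approximation engine -/

/-- **`HyperPolyApprox θ d y`**: for every level `m` there are `P ∈ ℤ[x₁,…,xₙ]` of total degree `≤ d`
and `E ≥ 1` with `y ≠ P(θ)/E` and `‖y − P(θ)/E‖ < exp(−(1 + E + mvlen P)^m)`. -/
def HyperPolyApprox (θ : Fin n → ℂ) (d : ℕ) (y : ℂ) : Prop :=
  ∀ m : ℕ, ∃ (P : MvPolynomial (Fin n) ℤ) (E : ℕ), 0 < E ∧ P.totalDegree ≤ d ∧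
    y ≠ MvPolynomial.aeval θ P / (E : ℂ) ∧
    ‖y - MvPolynomial.aeval θ P / (E : ℂ)‖ <
      Real.exp (-((1 + (E : ℝ) + ((mvlen P : ℤ) : ℝ)) ^ m))

/-- Levels are monotone: a hyper-approximation at level `m + t` is one at level `m`. -/
theorem HyperPolyApprox.mono_level {θ : Fin n → ℂ} {d : ℕ} {y : ℂ} (h : HyperPolyApprox θ d y)
    (t : ℕ) : ∀ m : ℕ, ∃ (P : MvPolynomial (Fin n) ℤ) (E : ℕ), 0 < E ∧ P.totalDegree ≤ d ∧
    y ≠ MvPolynomial.aeval θ P / (E : ℂ) ∧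
    ‖y - MvPolynomial.aeval θ P / (E : ℂ)‖ <
      Real.exp (-((1 + (E : ℝ) + ((mvlen P : ℤ) : ℝ)) ^ (m + t))) := fun m => h (m + t)

end HyperCell

end Summit.Schanuel.Schanuel.Theorems.RootDecomp1KHyper
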